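import Mathlib
import Summits.AtomisticToContinuum.HydrodynamicLimit.Theorems.ImplosionDichotomyDenseExcursionCavityCentreData
import Summits.AtomisticToContinuum.HydrodynamicLimit.Theorems.ImplosionDichotomyDenseExcursionCavityCentreFuchs

/-!
# The resolvent equation at the centre in the signed radius: the regular branch (for theorem T3, existence half)
# (crux `DenseExcursion`, line `sonic-cavity-renewal`, stub `stub_cavityResolventCk`)

Helper file (`--supports stmt-AtomisticToContinuum-12586`, line lead a2, stub-worker E for `stub_cavityResolventCk`,
theorem T3 `centre_regular_branch`, EXISTENCE half). Registered helper `centre_R_branch`: for a monatomic profile and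
`Λ : ℂ` there is `δ > 0` such that for every regular source `(f, g)` (`IsRegularPair`) and every `c₀ : ℂ` there are EVEN
functions `u, c : ℝ → ℂ`, `C^∞` on `(−δ, δ)`, `c(0) = c₀`, such that `ŵ(x) = u(eˣ)`, `ŝ(x) = e^{−x}c(eˣ)` solve the
resolvent equation `Λŵ − linW = f`, `Λŝ − linS = g` for `eˣ < δ`.

Mechanism. With the smooth even data `𝓌 = W(log|R|)`, `σ = |R|S(log|R|)`, `𝒻 = f(log|R|)`, `𝓰 = |R|g(log|R|)` of
`…CavityCentreData`, `R·W′ = R𝓌′`, `S = σ/R`, `S′ = σ′ − σ/R`, `ŵ′ = R u′`, `ŝ′ = c′ − c/R` turn `R·(W-row)` and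
`R·(S-row)` into `(𝓌−1)R·(Ru′) + 3σ·c′ = ℛ₁`, `(σ/3)(Ru′) + (𝓌−1)R·c′ = ℛ₂` (`lin_of_R_system`), i.e. — dividing by the
determinant `det = (𝓌−1)²R² − σ²`, `det(0) = −σ(0)² < 0`, globalised by `exists_even_nonvanishing_eq_near_zero` — the
Fuchsian system `R u′ = a₁₁u + a₁₂c + b₁`, `c′ = a₂₁u + a₂₂c + b₂` with `a₁₁(0) = 3σ(0)²/det(0) = −3`, even `a₁ⱼ, b₁`
and odd `a₂ⱼ, b₂`; `fuchs_negInt_branch` (`m = 3`) gives the smooth even regular branch, `δ` uniform in the source and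
in `c₀`. Sources: folklore.
-/

noncomputable section

open Set Filter
open scoped Topology ContDiff

namespace Summit.AtomisticToContinuum.HydrodynamicLimit.Theorems.SonicCavityRenewal

open Summit.AtomisticToContinuum.HydrodynamicLimit.Theorems.R2OneModeTwoConditions

/-! ## Pointwise algebra: from the `R`-system back to `linW`, `linS` -/

/-- FROM THE `R`-SYSTEM TO THE RESOLVENT EQUATION (pointwise algebra): if at `x`, with `R ≠ 0`, the profile reads
`W = w`, `W′ = Rw′`, `S = s/R`, `S′ = s′ − s/R`, the pair reads `ŵ = u`, `ŵ′ = R·uR`, `ŝ = c/R`, `ŝ′ = cR − c/R`, and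
`(w−1)R(R·uR) + 3s·cR = R(Λ − Rw′ − 2w + r)u − 3s′c − R·F`, `(s/3)(R·uR) + (w−1)R·cR = (Λ − 1 − w − Rw′/3 + r)c −
(Rs′ + s)u − Gs`, then `Λŵ − linW = F` and `Λŝ − linS = Gs/R` at `x`. [folklore] -/
theorem lin_of_R_system {r : ℝ} {W S : ℝ → ℝ} {Λ : ℂ} {ŵ ŝ : ℝ → ℂ} {x R w w' s s' : ℝ}
    {u c uR cR F Gs : ℂ} (hR : R ≠ 0) (hW : W x = w) (hW' : deriv W x = R * w') (hS : S x = s / R)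
    (hS' : deriv S x = s' - s / R) (hŵ : ŵ x = u) (hŵ' : deriv ŵ x = (R : ℂ) * uR) (hŝ : ŝ x = c / (R : ℂ))
    (hŝ' : deriv ŝ x = cR - c / (R : ℂ))
    (hE1 : (((w - 1) * R : ℝ) : ℂ) * ((R : ℂ) * uR) + ((3 * s : ℝ) : ℂ) * cR =
      (R : ℂ) * (Λ - ((R * w' + 2 * w - r : ℝ) : ℂ)) * u - ((3 * s' : ℝ) : ℂ) * c - (R : ℂ) * F)
    (hE2 : ((s / 3 : ℝ) : ℂ) * ((R : ℂ) * uR) + (((w - 1) * R : ℝ) : ℂ) * cR =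
      (Λ - ((1 + w + R * w' / 3 - r : ℝ) : ℂ)) * c - ((R * s' + s : ℝ) : ℂ) * u - Gs) :
    Λ * ŵ x - linW r W S ŵ ŝ x = F ∧ Λ * ŝ x - linS r W S ŵ ŝ x = Gs / (R : ℂ) := by
  have hRc : (R : ℂ) ≠ 0 := Complex.ofReal_ne_zero.2 hR
  unfold linW linS
  rw [hW, hW', hS, hS', hŵ, hŵ', hŝ, hŝ']
  push_cast at hE1 hE2 ⊢
  constructor
  · field_simp
    linear_combination (-(R : ℂ)) * hE1
  · field_simp
    linear_combination (-3 : ℂ) * hE2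

/-! ## Derivative relations along `R = eˣ` -/

/-- Chain rule along `R = eˣ` for `u`. [folklore] -/
theorem deriv_comp_exp {u : ℝ → ℂ} {x : ℝ} (hu : DifferentiableAt ℝ u (Real.exp x)) :
    deriv (fun y => u (Real.exp y)) x = (Real.exp x : ℂ) * deriv u (Real.exp x) := by
  have h := hu.hasDerivAt.scomp x (Real.hasDerivAt_exp x)
  rw [Complex.real_smul] at h
  exact h.deriv

/-- Chain rule along `R = eˣ` for `e^{−x} c(eˣ)`. [folklore] -/
theorem deriv_exp_neg_mul_comp_exp {c : ℝ → ℂ} {x : ℝ} (hc : DifferentiableAt ℝ c (Real.exp x)) :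
    deriv (fun y => (Real.exp (-y) : ℂ) * c (Real.exp y)) x =
      deriv c (Real.exp x) - c (Real.exp x) / (Real.exp x : ℂ) := by
  have h1 : HasDerivAt (fun y => (Real.exp (-y) : ℂ)) (-(Real.exp (-x) : ℂ)) x := by
    have h := ((Real.hasDerivAt_exp (-x)).scomp x (hasDerivAt_neg x)).ofReal_comp
    simpa using h
  have h2 : HasDerivAt (fun y => c (Real.exp y)) ((Real.exp x : ℂ) * deriv c (Real.exp x)) x := by
    have h := hc.hasDerivAt.scomp x (Real.hasDerivAt_exp x)
    rwa [Complex.real_smul] at h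
  have h3 : HasDerivAt (fun y => (Real.exp (-y) : ℂ) * c (Real.exp y))
      (-(Real.exp (-x) : ℂ) * c (Real.exp x) + (Real.exp (-x) : ℂ) * ((Real.exp x : ℂ) * deriv c (Real.exp x))) x :=
    h1.mul h2
  rw [h3.deriv]
  have he : (Real.exp (-x) : ℂ) * (Real.exp x : ℂ) = 1 := by
    rw [← Complex.ofReal_mul, ← Real.exp_add]; simp
  have he' : (Real.exp (-x) : ℂ) = (Real.exp x : ℂ)⁻¹ := by rw [Real.exp_neg]; push_cast; rfl
  rw [he', div_eq_mul_inv]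
  have hE : (Real.exp x : ℂ) ≠ 0 := Complex.ofReal_ne_zero.2 (Real.exp_pos x).ne'
  field_simp
  ring

/-- The derivative of an even differentiable function is odd. [folklore] -/
theorem deriv_neg_of_even {φ : ℝ → ℝ} (heven : ∀ R, φ (-R) = φ R) (R : ℝ) : deriv φ (-R) = -deriv φ R := by
  have h1 : (fun x => φ (-x)) = φ := funext heven
  have h2 : deriv (fun x => φ (-x)) R = -deriv φ (-R) := deriv_comp_neg φ R
  rw [h1] at h2
  linarith

/-! ## The regular branch in the signed radius -/

/-- **Registered helper `centre_R_branch`: THE REGULAR BRANCH OF THE RESOLVENT EQUATION AT THE CENTRE, IN THE SIGNED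
RADIUS.** See the module docstring. [folklore] -/
theorem centre_R_branch : ∀ (r : ℝ) (W S : ℝ → ℝ), IsMonatomicProfile r W S → ∀ (Λ : ℂ), ∃ δ : ℝ, 0 < δ ∧ ∀ (f g : ℝ → ℂ), IsRegularPair f g → ∀ c₀ : ℂ, ∃ u c : ℝ → ℂ, ContDiffOn ℝ ∞ u (Set.Ioo (-δ) δ) ∧ ContDiffOn ℝ ∞ c (Set.Ioo (-δ) δ) ∧ (∀ R, u (-R) = u R ∧ c (-R) = c R) ∧ c 0 = c₀ ∧ ∀ x : ℝ, Real.exp x < δ → Λ * u (Real.exp x) - linW r W S (fun y => u (Real.exp y)) (fun y => (Real.exp (-y) : ℂ) * c (Real.exp y)) x = f x ∧ Λ * ((Real.exp (-x) : ℂ) * c (Real.exp x)) - linS r W S (fun y => u (Real.exp y)) (fun y => (Real.exp (-y) : ℂ) * c (Real.exp y)) x = g x := by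
  intro r W S hP Λ
  obtain ⟨𝓌, σ, h𝓌, hσ, heven, hval, hσpos⟩ := profile_radial_data r W S hP
  have h𝓌' : ContDiff ℝ ∞ (deriv 𝓌) := (contDiff_infty_iff_deriv.1 h𝓌).2
  have hσ' : ContDiff ℝ ∞ (deriv σ) := (contDiff_infty_iff_deriv.1 hσ).2
  have h𝓌e : ∀ R, 𝓌 (-R) = 𝓌 R := fun R => (heven R).1
  have hσe : ∀ R, σ (-R) = σ R := fun R => (heven R).2
  have h𝓌'o : ∀ R, deriv 𝓌 (-R) = -deriv 𝓌 R := deriv_neg_of_even h𝓌e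
  have hσ'o : ∀ R, deriv σ (-R) = -deriv σ R := deriv_neg_of_even hσe
  -- the determinant and its globalisation
  set D : ℝ → ℝ := fun R => (𝓌 R - 1) ^ 2 * R ^ 2 - σ R ^ 2 with hD
  have hDs : ContDiff ℝ ∞ D := by rw [hD]; fun_prop
  have hDe : ∀ R, D (-R) = D R := fun R => by simp only [hD, h𝓌e, hσe]; ring
  have hD0 : D 0 < 0 := by
    simp only [hD]
    have := hσpos 0
    nlinarith
  obtain ⟨Dt, hDts, hDte, hDt0, ρ, hρ, hDtD⟩ := exists_even_nonvanishing_eq_near_zero hDs hDe hD0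
  -- the globalised coefficient functions
  set P : ℝ → ℂ := fun R => Λ - ((R * deriv 𝓌 R + 2 * 𝓌 R - r : ℝ) : ℂ) with hPdef
  set Q : ℝ → ℂ := fun R => Λ - ((1 + 𝓌 R + R * deriv 𝓌 R / 3 - r : ℝ) : ℂ) with hQdef
  set a₁₁ : ℝ → ℂ := fun R => ((((𝓌 R - 1) * R : ℝ) : ℂ) * ((R : ℂ) * P R) +
      ((3 * σ R : ℝ) : ℂ) * ((R * deriv σ R + σ R : ℝ) : ℂ)) * ((Dt R : ℝ) : ℂ)⁻¹ with ha₁₁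
  set a₁₂ : ℝ → ℂ := fun R => ((((𝓌 R - 1) * R : ℝ) : ℂ) * (-((3 * deriv σ R : ℝ) : ℂ)) -
      ((3 * σ R : ℝ) : ℂ) * Q R) * ((Dt R : ℝ) : ℂ)⁻¹ with ha₁₂
  set a₂₁ : ℝ → ℂ := fun R => (-((σ R / 3 : ℝ) : ℂ) * ((R : ℂ) * P R) -
      (((𝓌 R - 1) * R : ℝ) : ℂ) * ((R * deriv σ R + σ R : ℝ) : ℂ)) * ((Dt R : ℝ) : ℂ)⁻¹ with ha₂₁
  set a₂₂ : ℝ → ℂ := fun R => (((σ R / 3 : ℝ) : ℂ) * ((3 * deriv σ R : ℝ) : ℂ) +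
      (((𝓌 R - 1) * R : ℝ) : ℂ) * Q R) * ((Dt R : ℝ) : ℂ)⁻¹ with ha₂₂
  -- smoothness
  have cR : ContDiff ℝ ∞ fun R : ℝ => (R : ℂ) := Complex.ofRealCLM.contDiff
  have rP : ContDiff ℝ ∞ fun R : ℝ => R * deriv 𝓌 R + 2 * 𝓌 R - r := by fun_prop
  have rQ : ContDiff ℝ ∞ fun R : ℝ => 1 + 𝓌 R + R * deriv 𝓌 R / 3 - r := by fun_prop
  have r1 : ContDiff ℝ ∞ fun R : ℝ => (𝓌 R - 1) * R := by fun_prop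
  have r2 : ContDiff ℝ ∞ fun R : ℝ => 3 * σ R := by fun_prop
  have r3 : ContDiff ℝ ∞ fun R : ℝ => R * deriv σ R + σ R := by fun_prop
  have r4 : ContDiff ℝ ∞ fun R : ℝ => 3 * deriv σ R := by fun_prop
  have r5 : ContDiff ℝ ∞ fun R : ℝ => σ R / 3 := by fun_prop
  have hPs : ContDiff ℝ ∞ P := by
    rw [hPdef]; exact contDiff_const.sub (Complex.ofRealCLM.contDiff.comp rP)
  have hQs : ContDiff ℝ ∞ Q := by
    rw [hQdef]; exact contDiff_const.sub (Complex.ofRealCLM.contDiff.comp rQ)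
  have hDti : ContDiff ℝ ∞ fun R => ((Dt R : ℝ) : ℂ)⁻¹ :=
    (Complex.ofRealCLM.contDiff.comp hDts).inv fun R => Complex.ofReal_ne_zero.2 (hDt0 R)
  have c1 : ContDiff ℝ ∞ fun R => (((𝓌 R - 1) * R : ℝ) : ℂ) := Complex.ofRealCLM.contDiff.comp r1
  have c2 : ContDiff ℝ ∞ fun R => ((3 * σ R : ℝ) : ℂ) := Complex.ofRealCLM.contDiff.comp r2
  have c3 : ContDiff ℝ ∞ fun R => ((R * deriv σ R + σ R : ℝ) : ℂ) := Complex.ofRealCLM.contDiff.comp r3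
  have c4 : ContDiff ℝ ∞ fun R => ((3 * deriv σ R : ℝ) : ℂ) := Complex.ofRealCLM.contDiff.comp r4
  have c5 : ContDiff ℝ ∞ fun R => ((σ R / 3 : ℝ) : ℂ) := Complex.ofRealCLM.contDiff.comp r5
  have ha₁₁s : ContDiff ℝ ∞ a₁₁ := by
    rw [ha₁₁]; exact ((c1.mul (cR.mul hPs)).add (c2.mul c3)).mul hDti
  have ha₁₂s : ContDiff ℝ ∞ a₁₂ := by
    rw [ha₁₂]; exact ((c1.mul c4.neg).sub (c2.mul hQs)).mul hDti
  have ha₂₁s : ContDiff ℝ ∞ a₂₁ := by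
    rw [ha₂₁]; exact ((c5.neg.mul (cR.mul hPs)).sub (c1.mul c3)).mul hDti
  have ha₂₂s : ContDiff ℝ ∞ a₂₂ := by
    rw [ha₂₂]; exact ((c5.mul c4).add (c1.mul hQs)).mul hDti
  -- the residue
  have ha₁₁0 : a₁₁ 0 = -(3 : ℂ) := by
    have hDt00 : Dt 0 = -σ 0 ^ 2 := by rw [hDtD 0 (by simpa using hρ)]; simp [hD]
    have hσ0 : (σ 0 : ℂ) ≠ 0 := Complex.ofReal_ne_zero.2 (hσpos 0).ne'
    simp only [ha₁₁, hDt00]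
    push_cast
    field_simp
    ring
  -- parities of the coefficients
  have hPe : ∀ R, P (-R) = P R := fun R => by simp only [hPdef, h𝓌e, h𝓌'o]; push_cast; ring
  have hQe : ∀ R, Q (-R) = Q R := fun R => by simp only [hQdef, h𝓌e, h𝓌'o]; push_cast; ring
  have ha₁₁e : ∀ R, a₁₁ (-R) = a₁₁ R := fun R => by
    simp only [ha₁₁, hPe, h𝓌e, hσe, hσ'o, hDte]; push_cast; ring
  have ha₁₂e : ∀ R, a₁₂ (-R) = a₁₂ R := fun R => by
    simp only [ha₁₂, hQe, h𝓌e, hσe, hσ'o, hDte]; push_cast; ring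
  have ha₂₁o : ∀ R, a₂₁ (-R) = -a₂₁ R := fun R => by
    simp only [ha₂₁, hPe, h𝓌e, hσe, hσ'o, hDte]; push_cast; ring
  have ha₂₂o : ∀ R, a₂₂ (-R) = -a₂₂ R := fun R => by
    simp only [ha₂₂, hQe, h𝓌e, hσe, hσ'o, hDte]; push_cast; ring
  -- the smooth Fuchsian branch, `m = 3`
  obtain ⟨δ₀, hδ₀, hbranch⟩ := fuchs_negInt_branch 3 a₁₁ a₁₂ a₂₁ a₂₂ (by norm_num) ha₁₁s ha₁₂s ha₂₁s ha₂₂s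
    (by rw [ha₁₁0]; norm_num)
  set δ : ℝ := min δ₀ ρ with hδ
  have hδpos : 0 < δ := lt_min hδ₀ hρ
  refine ⟨δ, hδpos, fun f g hfg c₀ => ?_⟩
  obtain ⟨𝒻, 𝓰, h𝒻, h𝓰, hseven, hsval⟩ := source_radial_data hfg
  have h𝒻e : ∀ R, 𝒻 (-R) = 𝒻 R := fun R => (hseven R).1
  have h𝓰e : ∀ R, 𝓰 (-R) = 𝓰 R := fun R => (hseven R).2
  set b₁ : ℝ → ℂ := fun R => ((((𝓌 R - 1) * R : ℝ) : ℂ) * (-((R : ℂ) * 𝒻 R)) + ((3 * σ R : ℝ) : ℂ) * 𝓰 R) *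
    ((Dt R : ℝ) : ℂ)⁻¹ with hb₁
  set b₂ : ℝ → ℂ := fun R => (((σ R / 3 : ℝ) : ℂ) * ((R : ℂ) * 𝒻 R) - (((𝓌 R - 1) * R : ℝ) : ℂ) * 𝓰 R) *
    ((Dt R : ℝ) : ℂ)⁻¹ with hb₂
  have hb₁s : ContDiff ℝ ∞ b₁ := by
    rw [hb₁]; exact ((c1.mul (cR.mul h𝒻).neg).add (c2.mul h𝓰)).mul hDti
  have hb₂s : ContDiff ℝ ∞ b₂ := by
    rw [hb₂]; exact ((c5.mul (cR.mul h𝒻)).sub (c1.mul h𝓰)).mul hDti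
  have hb₁e : ∀ R, b₁ (-R) = b₁ R := fun R => by
    simp only [hb₁, h𝓌e, hσe, h𝒻e, h𝓰e, hDte]; push_cast; ring
  have hb₂o : ∀ R, b₂ (-R) = -b₂ R := fun R => by
    simp only [hb₂, h𝓌e, hσe, h𝒻e, h𝓰e, hDte]; push_cast; ring
  obtain ⟨u, c, hus, hcs, hc0, hode, hpar⟩ := hbranch b₁ b₂ hb₁s hb₂s c₀
  have hevenuc := hpar ha₁₁e ha₁₂e hb₁e ha₂₁o ha₂₂o hb₂o
  refine ⟨u, c, hus.mono (Ioo_subset_Ioo (by rw [hδ]; linarith [min_le_left δ₀ ρ]) (min_le_left _ _)),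
    hcs.mono (Ioo_subset_Ioo (by rw [hδ]; linarith [min_le_left δ₀ ρ]) (min_le_left _ _)), hevenuc, hc0,
    fun x hx => ?_⟩
  -- at `R = eˣ ∈ (0, δ)`
  set R : ℝ := Real.exp x with hRdef
  have hRpos : 0 < R := Real.exp_pos x
  have hR0 : R ≠ 0 := hRpos.ne'
  have hRabs : |R| = R := abs_of_pos hRpos
  have hlog : Real.log |R| = x := by rw [hRabs, hRdef, Real.log_exp]
  have hRI : R ∈ Ioo (-δ₀) δ₀ := ⟨by linarith [min_le_left δ₀ ρ], lt_of_lt_of_le hx (min_le_left _ _)⟩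
  have hRρ : |R| < ρ := by rw [hRabs]; exact lt_of_lt_of_le hx (min_le_right _ _)
  have hDtR : Dt R = (𝓌 R - 1) ^ 2 * R ^ 2 - σ R ^ 2 := hDtD R hRρ
  have hDR0 : (((𝓌 R - 1) ^ 2 * R ^ 2 - σ R ^ 2 : ℝ) : ℂ) ≠ 0 := by
    rw [← hDtR]; exact Complex.ofReal_ne_zero.2 (hDt0 R)
  have hDR0' : ((𝓌 R : ℂ) - 1) ^ 2 * (R : ℂ) ^ 2 - (σ R : ℂ) ^ 2 ≠ 0 := by exact_mod_cast hDR0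
  obtain ⟨h1, h2⟩ := hode R hRI
  -- the profile and the source along `R = eˣ`
  have hWfun : ∀ y, W y = 𝓌 (Real.exp y) := fun y => by
    have := (hval (Real.exp y) (Real.exp_pos y).ne').1
    rw [abs_of_pos (Real.exp_pos y), Real.log_exp] at this
    exact this.symm
  have hSfun : ∀ y, S y = σ (Real.exp y) * (Real.exp y)⁻¹ := fun y => by
    have := (hval (Real.exp y) (Real.exp_pos y).ne').2
    rw [abs_of_pos (Real.exp_pos y), Real.log_exp] at this
    rw [this]; field_simp
  have hW : W x = 𝓌 R := hWfun x
  have hW' : deriv W x = R * deriv 𝓌 R := by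
    have h : HasDerivAt (fun y => 𝓌 (Real.exp y)) (Real.exp x • deriv 𝓌 (Real.exp x)) x :=
      ((h𝓌.differentiable (by simp)) _).hasDerivAt.scomp x (Real.hasDerivAt_exp x)
    rw [show W = fun y => 𝓌 (Real.exp y) from funext hWfun, h.deriv, smul_eq_mul]
  have hS : S x = σ R / R := by rw [hSfun x, div_eq_mul_inv]
  have hS' : deriv S x = deriv σ R - σ R / R := by
    have h1' : HasDerivAt (fun y => σ (Real.exp y)) (Real.exp x • deriv σ (Real.exp x)) x :=
      ((hσ.differentiable (by simp)) _).hasDerivAt.scomp x (Real.hasDerivAt_exp x)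
    have h2' := (Real.hasDerivAt_exp x).inv (Real.exp_pos x).ne'
    have h3' : HasDerivAt (fun y => σ (Real.exp y) * (Real.exp y)⁻¹) _ x := h1'.mul h2'
    rw [show S = fun y => σ (Real.exp y) * (Real.exp y)⁻¹ from funext hSfun, h3'.deriv, smul_eq_mul]
    field_simp
    ring
  have hŵ' : deriv (fun y => u (Real.exp y)) x = (R : ℂ) * deriv u R :=
    deriv_comp_exp (((hus.differentiableOn (by simp)) R hRI).differentiableAt (isOpen_Ioo.mem_nhds hRI))
  have hŝ : (Real.exp (-x) : ℂ) * c (Real.exp x) = c R / (R : ℂ) := by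
    rw [Real.exp_neg, Complex.ofReal_inv, div_eq_inv_mul]
  have hŝ' : deriv (fun y => (Real.exp (-y) : ℂ) * c (Real.exp y)) x = deriv c R - c R / (R : ℂ) :=
    deriv_exp_neg_mul_comp_exp (((hcs.differentiableOn (by simp)) R hRI).differentiableAt (isOpen_Ioo.mem_nhds hRI))
  obtain ⟨hfR, hgR⟩ := hsval R hR0
  rw [hlog] at hfR hgR
  -- the `R`-system in `M`-form
  have hE1 : (((𝓌 R - 1) * R : ℝ) : ℂ) * ((R : ℂ) * deriv u R) + ((3 * σ R : ℝ) : ℂ) * deriv c R =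
      (R : ℂ) * (Λ - ((R * deriv 𝓌 R + 2 * 𝓌 R - r : ℝ) : ℂ)) * u R - ((3 * deriv σ R : ℝ) : ℂ) * c R - (R : ℂ) * 𝒻 R := by
    rw [h1, h2]
    simp only [ha₁₁, ha₁₂, hb₁, ha₂₁, ha₂₂, hb₂, hPdef, hQdef, hDtR]
    push_cast
    field_simp
    ring
  have hE2 : ((σ R / 3 : ℝ) : ℂ) * ((R : ℂ) * deriv u R) + (((𝓌 R - 1) * R : ℝ) : ℂ) * deriv c R =
      (Λ - ((1 + 𝓌 R + R * deriv 𝓌 R / 3 - r : ℝ) : ℂ)) * c R - ((R * deriv σ R + σ R : ℝ) : ℂ) * u R - 𝓰 R := by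
    rw [h1, h2]
    simp only [ha₁₁, ha₁₂, hb₁, ha₂₁, ha₂₂, hb₂, hPdef, hQdef, hDtR]
    push_cast
    field_simp
    ring
  obtain ⟨hw, hs⟩ := lin_of_R_system (Λ := Λ) (ŵ := fun y => u (Real.exp y))
    (ŝ := fun y => (Real.exp (-y) : ℂ) * c (Real.exp y)) hR0 hW hW' hS hS' rfl hŵ' hŝ hŝ' hE1 hE2
  refine ⟨by rw [hw, hfR], ?_⟩
  have hRc : (R : ℂ) ≠ 0 := Complex.ofReal_ne_zero.2 hR0
  rw [hs, hgR, hRabs]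
  field_simp

end Summit.AtomisticToContinuum.HydrodynamicLimit.Theorems.SonicCavityRenewal

end
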